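import Literature.Analysis.Complex.KoebeDistortion
import Mathlib.Analysis.Complex.AbsMax
import Mathlib.Analysis.Complex.Harmonic.Analytic
import Mathlib.Analysis.InnerProductSpace.Harmonic.Constructions
import HarnessLib

/-!
# Limits of normalised univalent maps: extraction, univalence of the limit, coverage of compacta

Topic `Literature/Analysis/Complex` (conformal maps; companion of `Montel.lean`, `Hurwitz.lean`,
`RiemannMapping.lean`, `KoebeDistortion.lean`). The "standard compactness properties of conformal
maps" invoked in G. F. Lawler, O. Schramm, W. Werner, *Conformal invariance of planar loop-erased
random walks and uniform spanning trees*, Ann. Probab. 32 (2004), proof of Lemma 5.3 (arXiv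
math/0112234, p. 28: "one can take a subsequence such that the maps `δ_n ψ_{D_n}⁻¹` converge
locally uniformly in `𝕌` to some conformal map, say `φ`. (This follows, for example, from the
Arzelà–Ascoli theorem, together with [Pommerenke, Thm. 1.3, Cor. 1.4])"), and the easy half of
Carathéodory's kernel theorem that goes with it (Ch. Pommerenke, *Boundary Behaviour of Conformal
Maps* (1992), §1.4, Thm. 1.8; P. Duren, *Univalent Functions* (1983), §3.1): compact subsets of the
image of the limit map are eventually covered by the images of the approximating maps.

* `harmonicOnNhd_comp_of_differentiableOn` — **harmonic ∘ holomorphic is harmonic** (locally a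
  harmonic function is the real part of a holomorphic one, Mathlib's
  `HarmonicOnNhd.exists_analyticOnNhd_ball_re_eq`); the transfer of harmonic functions between a
  domain and its conformal disc coordinates.
* `exists_subseq_tendstoLocallyUniformlyOn_univalent` — a sequence of univalent `F_n : 𝔻 → ℂ`
  with `F_n 0 = 0` and `a ≤ |F_n'(0)| ≤ A` (`a > 0`) has a subsequence converging locally uniformly
  on `𝔻`, with derivatives, to a UNIVALENT `Φ` with `Φ 0 = 0`, `a ≤ |Φ'(0)| ≤ A` (growth theorem
  `AreaThm.norm_sub_le_growth` for local boundedness, Montel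
  `Complex.exists_strictMono_tendstoLocallyUniformlyOn_deriv`, Hurwitz
  `Complex.exists_eqOn_const_or_injOn_of_tendstoLocallyUniformlyOn`, the lower derivative bound
  excluding constants).
* `eventually_image_closedBall_subset_image` — **kernel inclusion with margin**: if `F_n → Φ`
  locally uniformly on `𝔻` with `Φ` continuous and injective on `𝔻` and the `F_n` eventually
  holomorphic, then for `0 ≤ r < r' < 1`, eventually `Φ(B̄(0,r)) ⊆ F_n(B(0,r'))`. Proof without
  Rouché: `η = min {|Φ ζ - Φ ζ₀| : |ζ| = r', |ζ₀| ≤ r} > 0`; once `|F_n - Φ| < η/4` on `B̄(0,r')`, a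
  value `w = Φ ζ₀` missed by `F_n` on `B(0,r')` would make `1/(F_n - w)` holomorphic on the disc
  with `|·| ≤ 4/(3η)` on the circle, hence inside (maximum modulus,
  `Complex.norm_le_of_forall_mem_frontier_norm_le`), contradicting `|F_n ζ₀ - w| < η/4`.

Everything is proved, [folklore].

## References

* Ch. Pommerenke, *Boundary Behaviour of Conformal Maps*, Springer (1992), §1.3–1.4 (Thm. 1.3,
  Cor. 1.4, Thm. 1.8). [PommerenkeBBCM1992]
* G. F. Lawler, O. Schramm, W. Werner, Ann. Probab. 32 (2004), proof of Lemma 5.3.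
  [LawlerSchrammWerner2004]
-/

noncomputable section

open Set Filter Metric Function
open _root_.Complex _root_.Topology InnerProductSpace

namespace Literature.Analysis.Complex

/-! ### Harmonic functions in conformal coordinates -/

/-- **A harmonic function composed with a holomorphic map is harmonic**: if `H` is harmonic on the
open set `V` and `g` is holomorphic on the open set `U` with `g(U) ⊆ V`, then `H ∘ g` is harmonic
on `U`. (Locally `H = re Φ` with `Φ` holomorphic, and `re (Φ ∘ g)` is harmonic.) [folklore] -/
theorem harmonicOnNhd_comp_of_differentiableOn {H : ℂ → ℝ} {V U : Set ℂ} (hH : HarmonicOnNhd H V)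
    (hV : IsOpen V) {g : ℂ → ℂ} (hg : DifferentiableOn ℂ g U) (hU : IsOpen U)
    (hmaps : MapsTo g U V) : HarmonicOnNhd (fun z => H (g z)) U := by
  intro w hw
  obtain ⟨ρ, hρ, hball⟩ := Metric.isOpen_iff.1 hV _ (hmaps hw)
  obtain ⟨Φ, hΦa, hΦre⟩ := (hH.mono hball).exists_analyticOnNhd_ball_re_eq
  have hcont : ContinuousAt g w := hg.continuousOn.continuousAt (hU.mem_nhds hw)
  have hpre : g ⁻¹' ball (g w) ρ ∈ 𝓝 w := hcont.preimage_mem_nhds (ball_mem_nhds _ hρ)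
  have hev : (fun z => H (g z)) =ᶠ[𝓝 w] fun z => (Φ (g z)).re := by
    filter_upwards [hpre] with v hv
    exact (hΦre hv).symm
  refine (harmonicAt_congr_nhds hev).2 ?_
  have hga : AnalyticAt ℂ g w := hg.analyticAt (hU.mem_nhds hw)
  exact ((hΦa _ (mem_ball_self hρ)).comp_of_eq hga rfl).harmonicAt_re

/-! ### Normal families of normalised univalent maps -/

/-- **Subsequential limits of normalised univalent maps are univalent.** Let `F_n` be holomorphic
and injective on `𝔻` with `F_n 0 = 0` and `a ≤ |F_n'(0)| ≤ A` for some `a > 0`. Then along a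
subsequence `F_n → Φ` locally uniformly on `𝔻` together with the derivatives, where `Φ` is
holomorphic and INJECTIVE on `𝔻`, `Φ 0 = 0` and `a ≤ |Φ'(0)| ≤ A`. (Growth theorem ⇒ locally
bounded ⇒ Montel; Hurwitz: the limit is constant or injective, and `|Φ'(0)| ≥ a > 0` excludes
constants.) This is the compactness of `{f ∈ S}`-type families used for `δ_n ψ_{D_n}⁻¹` in
Lawler–Schramm–Werner's Lemma 5.3. [cite: PommerenkeBBCM1992, Thm. 1.3, Cor. 1.4] -/
theorem exists_subseq_tendstoLocallyUniformlyOn_univalent {F : ℕ → ℂ → ℂ}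
    (hF : ∀ n, DifferentiableOn ℂ (F n) (ball 0 1)) (hinj : ∀ n, InjOn (F n) (ball 0 1))
    (h0 : ∀ n, F n 0 = 0) {a A : ℝ} (ha : 0 < a) (hlo : ∀ n, a ≤ ‖deriv (F n) 0‖)
    (hhi : ∀ n, ‖deriv (F n) 0‖ ≤ A) :
    ∃ φ : ℕ → ℕ, StrictMono φ ∧ ∃ Φ : ℂ → ℂ, DifferentiableOn ℂ Φ (ball 0 1) ∧
      InjOn Φ (ball 0 1) ∧ Φ 0 = 0 ∧ a ≤ ‖deriv Φ 0‖ ∧ ‖deriv Φ 0‖ ≤ A ∧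
      TendstoLocallyUniformlyOn (fun n => F (φ n)) Φ atTop (ball 0 1) ∧
      TendstoLocallyUniformlyOn (fun n => deriv (F (φ n))) (deriv Φ) atTop (ball 0 1) := by
  have hA : 0 ≤ A := (ha.le.trans (hlo 0)).trans (hhi 0)
  -- the growth bound `x/(1-x)²` is monotone in the radius `x ∈ [0,1)`
  have hmono : ∀ {x s : ℝ}, 0 ≤ x → x ≤ s → s < 1 → x / (1 - x) ^ 2 ≤ s / (1 - s) ^ 2 := by
    intro x s hx hxs hs
    have h1 : 0 < 1 - s := by linarith
    have h2 : 0 < 1 - x := by linarith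
    rw [div_le_div_iff₀ (by positivity) (by positivity)]
    have hxs1 : x * s ≤ 1 := by nlinarith
    nlinarith [mul_nonneg (sub_nonneg.2 hxs) (sub_nonneg.2 hxs1)]
  -- local boundedness by the growth theorem
  have hb : ∀ c ∈ ball (0 : ℂ) 1, ∃ M : ℝ, ∃ r > 0, ∀ n, ∀ z ∈ ball c r ∩ ball 0 1,
      ‖F n z‖ ≤ M := by
    intro c hc
    rw [mem_ball, dist_zero_right] at hc
    set s : ℝ := (1 + ‖c‖) / 2 with hs
    have hs1 : s < 1 := by rw [hs]; linarith
    have hs0 : 0 ≤ s := by positivity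
    refine ⟨A * (s / (1 - s) ^ 2), (1 - ‖c‖) / 2, by linarith, fun n z hz => ?_⟩
    have hz1 : ‖z‖ ≤ s := by
      have h1 : dist z c < (1 - ‖c‖) / 2 := hz.1
      rw [dist_eq_norm] at h1
      calc ‖z‖ = ‖(z - c) + c‖ := by rw [sub_add_cancel]
        _ ≤ ‖z - c‖ + ‖c‖ := norm_add_le _ _
        _ ≤ s := by rw [hs]; linarith
    have hz' : ‖z‖ < 1 := lt_of_le_of_lt hz1 hs1
    have hgrowth := AreaThm.norm_sub_le_growth (hF n) (hinj n) hz'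
    rw [h0 n, sub_zero] at hgrowth
    refine hgrowth.trans ?_
    exact mul_le_mul (hhi n) (hmono (norm_nonneg z) hz1 hs1) (by positivity) hA
  obtain ⟨Φ, φ, hφ, hΦd, hlim, hlim'⟩ :=
    Complex.exists_strictMono_tendstoLocallyUniformlyOn_deriv isOpen_ball hF hb
  have hmem0 : (0 : ℂ) ∈ ball (0 : ℂ) 1 := mem_ball_self one_pos
  -- `Φ 0 = 0`
  have hΦ0 : Φ 0 = 0 := by
    have h1 : Tendsto (fun n => F (φ n) 0) atTop (𝓝 (Φ 0)) := hlim.tendsto_at hmem0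
    simp only [h0] at h1
    exact (tendsto_const_nhds_iff.1 h1).symm
  -- `a ≤ |Φ'(0)| ≤ A`
  have h2 : Tendsto (fun n => ‖deriv (F (φ n)) 0‖) atTop (𝓝 ‖deriv Φ 0‖) :=
    (continuous_norm.tendsto _).comp (hlim'.tendsto_at hmem0)
  have hlo' : a ≤ ‖deriv Φ 0‖ := ge_of_tendsto' h2 fun n => hlo (φ n)
  have hhi' : ‖deriv Φ 0‖ ≤ A := le_of_tendsto' h2 fun n => hhi (φ n)
  -- injectivity by Hurwitz
  have hinjΦ : InjOn Φ (ball 0 1) := by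
    rcases Complex.exists_eqOn_const_or_injOn_of_tendstoLocallyUniformlyOn isOpen_ball
        (convex_ball (0 : ℂ) 1).isPreconnected (Eventually.of_forall fun n => hF (φ n))
        (Eventually.of_forall fun n => hinj (φ n)) hlim with ⟨c, hc⟩ | h
    · exfalso
      have hev : Φ =ᶠ[𝓝 0] fun _ => c := hc.eventuallyEq_of_mem (ball_mem_nhds 0 one_pos)
      have hd : deriv Φ 0 = 0 := by rw [hev.deriv_eq, deriv_const]
      rw [hd, norm_zero] at hlo'
      linarith
    · exact h
  exact ⟨φ, hφ, Φ, hΦd, hinjΦ, hΦ0, hlo', hhi', hlim, hlim'⟩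

/-! ### Kernel inclusion: compacta of the limit image are eventually covered -/

/-- **Kernel inclusion with margin (easy half of Carathéodory's kernel theorem).** Let
`F_n → Φ` locally uniformly on `𝔻`, the `F_n` eventually holomorphic, `Φ` continuous and
injective on `𝔻`, and `0 ≤ r < r' < 1`. Then eventually `Φ(B̄(0, r)) ⊆ F_n(B(0, r'))`: every
value taken by the limit on the smaller closed disc is taken by `F_n` on the larger open disc.
(Minimum of `|Φ ζ - Φ ζ₀|` over `|ζ| = r'`, `|ζ₀| ≤ r` and the maximum modulus principle for
`1/(F_n - Φ ζ₀)`.) [cite: PommerenkeBBCM1992, §1.4 Thm. 1.8] -/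
theorem eventually_image_closedBall_subset_image {F : ℕ → ℂ → ℂ} {Φ : ℂ → ℂ}
    (hF : ∀ᶠ n in atTop, DifferentiableOn ℂ (F n) (ball 0 1))
    (hΦc : ContinuousOn Φ (ball 0 1)) (hΦinj : InjOn Φ (ball 0 1))
    (hlim : TendstoLocallyUniformlyOn F Φ atTop (ball 0 1))
    {r r' : ℝ} (hr : 0 ≤ r) (hrr' : r < r') (hr' : r' < 1) :
    ∀ᶠ n in atTop, Φ '' closedBall 0 r ⊆ F n '' ball 0 r' := by
  have hr'0 : 0 < r' := lt_of_le_of_lt hr hrr'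
  have hsph : sphere (0 : ℂ) r' ⊆ ball 0 1 := sphere_subset_closedBall.trans (closedBall_subset_ball hr')
  have hcb : closedBall (0 : ℂ) r ⊆ ball 0 1 := closedBall_subset_ball (lt_trans hrr' hr')
  -- the separation constant `η`
  set K : Set (ℂ × ℂ) := sphere (0 : ℂ) r' ×ˢ closedBall (0 : ℂ) r with hK
  have hKc : IsCompact K := (isCompact_sphere _ _).prod (isCompact_closedBall _ _)
  have hKne : K.Nonempty := by
    refine ⟨((r' : ℂ), 0), ?_, ?_⟩
    · rw [mem_sphere_zero_iff_norm, Complex.norm_real, Real.norm_eq_abs, abs_of_pos hr'0]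
    · exact mem_closedBall_self hr
  have hcont : ContinuousOn (fun p : ℂ × ℂ => ‖Φ p.1 - Φ p.2‖) K := by
    refine ContinuousOn.norm (ContinuousOn.sub ?_ ?_)
    · exact hΦc.comp continuousOn_fst fun p hp => hsph hp.1
    · exact hΦc.comp continuousOn_snd fun p hp => hcb hp.2
  obtain ⟨p₀, hp₀, hmin⟩ := hKc.exists_isMinOn hKne hcont
  set η : ℝ := ‖Φ p₀.1 - Φ p₀.2‖ with hη
  have hηpos : 0 < η := by
    have hne : p₀.1 ≠ p₀.2 := by
      intro h
      have h1 : ‖p₀.1‖ = r' := mem_sphere_zero_iff_norm.1 hp₀.1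
      have h2 : ‖p₀.2‖ ≤ r := mem_closedBall_zero_iff.1 hp₀.2
      rw [h] at h1
      linarith
    exact norm_pos_iff.2 (sub_ne_zero.2 fun h => hne (hΦinj (hsph hp₀.1) (hcb hp₀.2) h))
  have hmin' : ∀ ζ ∈ sphere (0 : ℂ) r', ∀ ζ₀ ∈ closedBall (0 : ℂ) r, η ≤ ‖Φ ζ - Φ ζ₀‖ :=
    fun ζ hζ ζ₀ hζ₀ => hmin (mk_mem_prod hζ hζ₀)
  -- uniform convergence on the closed disc of radius `r'`
  have hunif : TendstoUniformlyOn F Φ atTop (closedBall 0 r') :=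
    (tendstoLocallyUniformlyOn_iff_forall_isCompact isOpen_ball).1 hlim _
      (closedBall_subset_ball hr') (isCompact_closedBall _ _)
  have hev : ∀ᶠ n in atTop, ∀ ζ ∈ closedBall (0 : ℂ) r', dist (Φ ζ) (F n ζ) < η / 4 :=
    Metric.tendstoUniformlyOn_iff.1 hunif _ (by positivity)
  filter_upwards [hF, hev] with n hFn hn
  rintro _ ⟨ζ₀, hζ₀, rfl⟩
  by_contra hnot
  have hζ₀' : ζ₀ ∈ closedBall (0 : ℂ) r' := closedBall_subset_closedBall hrr'.le hζ₀
  -- `F n - Φ ζ₀` has no zero on the closed disc of radius `r'`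
  have hzf : ∀ ζ ∈ closedBall (0 : ℂ) r', F n ζ - Φ ζ₀ ≠ 0 := by
    intro ζ hζ h0
    have hζn : ‖ζ‖ ≤ r' := mem_closedBall_zero_iff.1 hζ
    rcases hζn.lt_or_eq with hlt | heq
    · exact hnot ⟨ζ, mem_ball_zero_iff.2 hlt, sub_eq_zero.1 h0⟩
    · have h1 := hmin' ζ (mem_sphere_zero_iff_norm.2 heq) ζ₀ hζ₀
      have h2 := hn ζ hζ
      rw [dist_eq_norm] at h2
      have h3 : ‖Φ ζ - Φ ζ₀‖ ≤ ‖Φ ζ - F n ζ‖ + ‖F n ζ - Φ ζ₀‖ :=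
        norm_sub_le_norm_sub_add_norm_sub _ _ _
      rw [h0, norm_zero, add_zero] at h3
      linarith
  -- the reciprocal is holomorphic on the disc and continuous on its closure
  set g : ℂ → ℂ := fun ζ => (F n ζ - Φ ζ₀)⁻¹ with hg
  have hgd : DiffContOnCl ℂ g (ball 0 r') := by
    refine ⟨?_, ?_⟩
    · exact ((hFn.mono (ball_subset_ball hr'.le)).sub_const _).inv
        fun ζ hζ => hzf ζ (ball_subset_closedBall hζ)
    · rw [closure_ball 0 hr'0.ne']
      exact ((hFn.continuousOn.mono (closedBall_subset_ball hr')).sub continuousOn_const).inv₀ hzf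
  -- on the circle `|g| ≤ 4/(3η)`
  have hfront : ∀ ζ ∈ frontier (ball (0 : ℂ) r'), ‖g ζ‖ ≤ (3 * η / 4)⁻¹ := by
    rw [frontier_ball 0 hr'0.ne']
    intro ζ hζ
    have h1 := hmin' ζ hζ ζ₀ hζ₀
    have h2 := hn ζ (sphere_subset_closedBall hζ)
    rw [dist_eq_norm] at h2
    have h3 : ‖Φ ζ - Φ ζ₀‖ ≤ ‖Φ ζ - F n ζ‖ + ‖F n ζ - Φ ζ₀‖ :=
      norm_sub_le_norm_sub_add_norm_sub _ _ _
    have h4 : 3 * η / 4 ≤ ‖F n ζ - Φ ζ₀‖ := by linarith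
    rw [hg, norm_inv]
    exact inv_anti₀ (by positivity) h4
  have hz0 : ζ₀ ∈ closure (ball (0 : ℂ) r') := by
    rw [closure_ball 0 hr'0.ne']
    exact hζ₀'
  have hle := Complex.norm_le_of_forall_mem_frontier_norm_le isBounded_ball hgd hfront hz0
  -- but at `ζ₀` the reciprocal is large
  have h5 := hn ζ₀ hζ₀'
  rw [dist_eq_norm, norm_sub_rev] at h5
  have hpos : 0 < ‖F n ζ₀ - Φ ζ₀‖ := norm_pos_iff.2 (hzf ζ₀ hζ₀')
  have hgt : (3 * η / 4)⁻¹ < ‖g ζ₀‖ := by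
    rw [hg, norm_inv]
    exact (inv_lt_inv₀ (by positivity) hpos).2 (by linarith)
  exact absurd hle (not_le.2 hgt)

/-- **Kernel inclusion for compact sets in disc coordinates**: under the hypotheses of
`eventually_image_closedBall_subset_image`, every compact `L ⊆ 𝔻` has `Φ(L)` eventually inside
`F_n(B(0, r'))` for any `r' < 1` with `L ⊆ B̄(0, r)`, `r < r'`; in particular eventually inside
`F_n(𝔻)`. [cite: PommerenkeBBCM1992, §1.4 Thm. 1.8] -/
theorem eventually_image_subset_image_ball {F : ℕ → ℂ → ℂ} {Φ : ℂ → ℂ}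
    (hF : ∀ᶠ n in atTop, DifferentiableOn ℂ (F n) (ball 0 1))
    (hΦc : ContinuousOn Φ (ball 0 1)) (hΦinj : InjOn Φ (ball 0 1))
    (hlim : TendstoLocallyUniformlyOn F Φ atTop (ball 0 1)) {L : Set ℂ} (hL : IsCompact L)
    (hL1 : L ⊆ ball 0 1) : ∀ᶠ n in atTop, Φ '' L ⊆ F n '' ball 0 1 := by
  -- `L` lies in a closed disc of radius `r < 1`
  obtain ⟨r, hr0, hr1, hLr⟩ : ∃ r, 0 ≤ r ∧ r < 1 ∧ L ⊆ closedBall (0 : ℂ) r := by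
    rcases L.eq_empty_or_nonempty with rfl | hne
    · exact ⟨0, le_rfl, one_pos, empty_subset _⟩
    · obtain ⟨z₀, hz₀, hmax⟩ := hL.exists_isMaxOn hne continuous_norm.continuousOn
      exact ⟨‖z₀‖, norm_nonneg _, mem_ball_zero_iff.1 (hL1 hz₀),
        fun z hz => mem_closedBall_zero_iff.2 (hmax hz)⟩
  have h := eventually_image_closedBall_subset_image hF hΦc hΦinj hlim hr0
    (by linarith : r < (r + 1) / 2) (by linarith : (r + 1) / 2 < 1)
  filter_upwards [h] with n hn
  exact (image_mono hLr).trans (hn.trans (image_mono (ball_subset_ball (by linarith))))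

end Literature.Analysis.Complex

end
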